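import Summits.CriticalPhenomena.PercolationContinuityZ3.Theorems.PercNearOneGluingNoHeavyLowerTailQ44ComplementaryPacking
import HarnessLib
import HarnessLib.Audit.Tags

/-!
# The packing `U` for all `n` from an ABSTRACT typed-configuration count (the socket `COUNT*`)

Support file for crux `stmt-CriticalPhenomena-4575` (master-family programme; the complementary-pair packing `U` and its siblings
`S1, S2, S3` of `prim-bnk-1` gen 34), seat `prim-bnk-1` gen 35; memo
`run/shared/lean/prim/prim-l12/FROM-prim-bnk-1-gen35-U-PACKING-HALL.md` §2.

`…Q44ComplementaryPacking` reduces `U ≥ 0 ∀n` to the fibre count `2g ≥ 2f + h` over monotone cell maps `ι` (`TwoCopyMono.goodKernel_kerU_iff_count`).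
This file records the observation of the memo (§2) that the count needs only the goods FORCED BY PAIRS OF BAD POINTS, and therefore
follows from a statement about abstract typed set systems:

* A *U-configuration* on a finite type `γ` is a value map `v : Finset γ → Fin 15` together with a family `𝒴` of "crossing sides":
  sets `Y` whose type `(v Yᶜ, v Y)` is one of the 14 oriented `U`-types `PackU.uTypesY` (`(ab|cy, d)` with `d ∈ D°` — weight 2 — or a dart
  `(p, t)` — weight 1), such that `v` is ORDER-CONSISTENT ON THE SIDES (`S ⊆ S' ⇒ ple (v S) (v S')` for `S, S'` among the `Y`'s and their
  complements).  Nothing else about `v` is used.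
* The *forced goods* `PackU.forcedGoods v 𝒴` are the corners `Y ∪ Y'`, `Y ∪ Y'ᶜ`, `Yᶜ ∪ Y'ᶜ` (`Y, Y' ∈ 𝒴`) whose value is forced to be `1̂` with
  complement forced to `0̂` by the join/meet tables (`PackU.joinTop`, `PackU.meetBot`), and which contain some member of `𝒴`.
* **`PackU.AbstractCount`** (`COUNT*` of the memo; OPEN; verified for all 23 149 572 consistent configurations on `|γ| ≤ 5` and on all
  70.8 M monotone maps of `B₄` / 97.1 M unit-step maps of `B₅`): `2·#{B-type members} + #{dart members} ≤ 2·#forcedGoods`.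
* `PackU.forcedGoods_good` — along a monotone cell map every forced good `T` has `ι T = 1̂`, `ι Tᶜ = 0̂`;
* **`PackU.goodKernel_kerU_of_abstractCount`** and **`PackU.packU_of_abstractCount`** — `COUNT* ⟹ GoodKernel kerU ⟹ U ≥ 0` on every
  finite weighted graph, all `n`.
Pure finite combinatorics + table facts by `decide`; no sorries, no named facts, standard axioms.  The hypothesis is the open statement.
-/

namespace Summit.CriticalPhenomena.PercolationContinuityZ3.Theorems

namespace PackU

open Finset FourPointAtoms TwoCopyMono

/-! ## Types and table facts -/

/-- The 14 oriented `U`-types `(x, y)` = (value of the `ab|cy`/pair side, value of the crossing/three-block side). [this work] -/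
def uTypesY : Finset (Fin 15 × Fin 15) :=
  {(11, 2), (11, 3), (11, 4), (11, 5), (11, 8), (11, 9), (2, 10), (2, 13), (3, 10), (3, 12), (4, 7), (4, 13), (5, 7), (5, 12)}

/-- The six `B`-types among them (weight 2). [this work] -/
def uBY : Finset (Fin 15 × Fin 15) := {(11, 2), (11, 3), (11, 4), (11, 5), (11, 8), (11, 9)}

/-- The eight dart types among them (weight 1). [this work] -/
def uDY : Finset (Fin 15 × Fin 15) := {(2, 10), (2, 13), (3, 10), (3, 12), (4, 7), (4, 13), (5, 7), (5, 12)}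

/-- Join table: every cell above both `i` and `j` is the top cell `abcy`. [this work] -/
def joinTop (i j : Fin 15) : Bool := decide (∀ k : Fin 15, ple i k = true → ple j k = true → k = 14)

/-- Meet table: every cell below both `i` and `j` is the bottom cell `a|b|c|y`. [this work] -/
def meetBot (i j : Fin 15) : Bool := decide (∀ k : Fin 15, ple k i = true → ple k j = true → k = 0)

/-- The `U`-types are the `B`-types and the dart types. [this work] -/
theorem uTypesY_eq : uTypesY = uBY ∪ uDY := by decide

/-- `uB` is `uBY` in both orientations (table). [this work] -/
theorem mem_uB_iff (i j : Fin 15) : (i, j) ∈ uB ↔ (i, j) ∈ uBY ∨ (j, i) ∈ uBY := by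
  revert i j; decide

/-- `uD` is `uDY` in both orientations (table). [this work] -/
theorem mem_uD_iff (i j : Fin 15) : (i, j) ∈ uD ↔ (i, j) ∈ uDY ∨ (j, i) ∈ uDY := by
  revert i j; decide

/-- `uTop` is `(abcy, a|b|c|y)` in both orientations (table). [this work] -/
theorem mem_uTop_iff (i j : Fin 15) : (i, j) ∈ uTop ↔ (i = 14 ∧ j = 0) ∨ (j = 14 ∧ i = 0) := by
  revert i j; decide

/-- No `B`-type is the reverse of a `B`-type (table). [this work] -/
theorem uBY_asymm (i j : Fin 15) : (i, j) ∈ uBY → (j, i) ∉ uBY := by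
  revert i j; decide

/-- No dart type is the reverse of a dart type (table). [this work] -/
theorem uDY_asymm (i j : Fin 15) : (i, j) ∈ uDY → (j, i) ∉ uDY := by
  revert i j; decide

/-- The good pair is not its own reverse (table). [this work] -/
theorem top_asymm (i j : Fin 15) : (i = 14 ∧ j = 0) → ¬ (j = 14 ∧ i = 0) := by
  revert i j; decide

/-! ## Configurations, forced goods, the abstract count -/

variable {γ : Type*} [Fintype γ] [DecidableEq γ]

/-- The three kinds of pair-forced corners of two crossing sides `Y, Y'` under the value map `v`. [this work] -/
def corners (v : Finset γ → Fin 15) (Y Y' : Finset γ) : Finset (Finset γ) :=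
  (if joinTop (v Y) (v Y') = true ∧ meetBot (v Yᶜ) (v Y'ᶜ) = true then {Y ∪ Y'} else ∅) ∪
    ((if joinTop (v Y) (v Y'ᶜ) = true ∧ meetBot (v Yᶜ) (v Y') = true then {Y ∪ Y'ᶜ} else ∅) ∪
      (if joinTop (v Yᶜ) (v Y'ᶜ) = true ∧ meetBot (v Y) (v Y') = true then {Yᶜ ∪ Y'ᶜ} else ∅))

/-- **Forced goods** of a configuration: pair-forced corners containing some crossing side. [this work] -/
def forcedGoods (v : Finset γ → Fin 15) (𝒴 : Finset (Finset γ)) : Finset (Finset γ) :=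
  ((𝒴 ×ˢ 𝒴).biUnion fun p => corners v p.1 p.2).filter fun T => ∃ Y ∈ 𝒴, Y ⊆ T

/-- The sides of a configuration: the crossing sides and their complements. [this work] -/
def sides (𝒴 : Finset (Finset γ)) : Finset (Finset γ) := 𝒴 ∪ 𝒴.image compl

/-- **`COUNT*` (abstract typed-configuration count; OPEN, memo gen 35 §2).**  For every finite type, every value map `v` and every family
`𝒴` of crossing sides carrying `U`-types and order-consistent on its sides:
`2·#{Y ∈ 𝒴 : B-type} + #{Y ∈ 𝒴 : dart type} ≤ 2·#forcedGoods v 𝒴`. [this work] -/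
@[conjecture] def AbstractCount : Prop :=
  ∀ (γ : Type) [Fintype γ] [DecidableEq γ] (v : Finset γ → Fin 15) (𝒴 : Finset (Finset γ)),
    (∀ Y ∈ 𝒴, (v Yᶜ, v Y) ∈ uTypesY) →
      (∀ S ∈ sides 𝒴, ∀ S' ∈ sides 𝒴, S ⊆ S' → ple (v S) (v S') = true) →
        2 * #(𝒴.filter fun Y => (v Yᶜ, v Y) ∈ uBY) + #(𝒴.filter fun Y => (v Yᶜ, v Y) ∈ uDY) ≤ 2 * #(forcedGoods v 𝒴)

/-! ## Forced goods are goods along a monotone cell map -/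

/-- Reading the join table. [this work] -/
theorem eq_top_of_joinTop {i j k : Fin 15} (h : joinTop i j = true) (hi : ple i k = true) (hj : ple j k = true) : k = 14 := by
  unfold joinTop at h; rw [decide_eq_true_iff] at h; exact h k hi hj

/-- Reading the meet table. [this work] -/
theorem eq_bot_of_meetBot {i j k : Fin 15} (h : meetBot i j = true) (hi : ple k i = true) (hj : ple k j = true) : k = 0 := by
  unfold meetBot at h; rw [decide_eq_true_iff] at h; exact h k hi hj

/-- A corner whose two generators have top join and whose complement's generators have bottom meet is a good. [this work] -/
theorem good_of_tables (ι : Finset γ → Fin 15) (hmono : ∀ A B : Finset γ, A ⊆ B → ple (ι A) (ι B) = true)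
    (P Q : Finset γ) (hj : joinTop (ι P) (ι Q) = true) (hm : meetBot (ι Pᶜ) (ι Qᶜ) = true) :
    ι (P ∪ Q) = 14 ∧ ι (P ∪ Q)ᶜ = 0 := by
  refine ⟨eq_top_of_joinTop hj (hmono _ _ subset_union_left) (hmono _ _ subset_union_right), ?_⟩
  refine eq_bot_of_meetBot hm (hmono _ _ ?_) (hmono _ _ ?_)
  · rw [Finset.compl_union]; exact Finset.inter_subset_left
  · rw [Finset.compl_union]; exact Finset.inter_subset_right

/-- Members of `corners` are goods along a monotone cell map. [this work] -/
theorem corners_good (ι : Finset γ → Fin 15) (hmono : ∀ A B : Finset γ, A ⊆ B → ple (ι A) (ι B) = true)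
    (Y Y' T : Finset γ) (hT : T ∈ corners ι Y Y') : ι T = 14 ∧ ι Tᶜ = 0 := by
  unfold corners at hT
  rcases Finset.mem_union.1 hT with h1 | h23
  · split_ifs at h1 with hc
    · rw [Finset.mem_singleton] at h1; subst h1
      exact good_of_tables ι hmono Y Y' hc.1 hc.2
    · exact absurd h1 (Finset.notMem_empty _)
  · rcases Finset.mem_union.1 h23 with h2 | h3
    · split_ifs at h2 with hc
      · rw [Finset.mem_singleton] at h2; subst h2
        have hm : meetBot (ι Yᶜ) (ι Y'ᶜᶜ) = true := by rw [compl_compl]; exact hc.2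
        exact good_of_tables ι hmono Y Y'ᶜ hc.1 hm
      · exact absurd h2 (Finset.notMem_empty _)
    · split_ifs at h3 with hc
      · rw [Finset.mem_singleton] at h3; subst h3
        have hm : meetBot (ι Yᶜᶜ) (ι Y'ᶜᶜ) = true := by rw [compl_compl, compl_compl]; exact hc.2
        exact good_of_tables ι hmono Yᶜ Y'ᶜ hc.1 hm
      · exact absurd h3 (Finset.notMem_empty _)

/-- **Forced goods are goods**: along a monotone cell map every member `T` of `forcedGoods ι 𝒴` has `ι T = abcy` and `ι Tᶜ = a|b|c|y`.
[this work] -/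
theorem forcedGoods_good (ι : Finset γ → Fin 15) (hmono : ∀ A B : Finset γ, A ⊆ B → ple (ι A) (ι B) = true)
    (𝒴 : Finset (Finset γ)) (T : Finset γ) (hT : T ∈ forcedGoods ι 𝒴) : ι T = 14 ∧ ι Tᶜ = 0 := by
  unfold forcedGoods at hT
  rw [Finset.mem_filter, Finset.mem_biUnion] at hT
  obtain ⟨⟨p, _, hp⟩, _⟩ := hT
  exact corners_good ι hmono p.1 p.2 T hp

/-- Hence the forced goods are among the goods, and are at most as many. [this work] -/
theorem card_forcedGoods_le (ι : Finset γ → Fin 15) (hmono : ∀ A B : Finset γ, A ⊆ B → ple (ι A) (ι B) = true)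
    (𝒴 : Finset (Finset γ)) :
    #(forcedGoods ι 𝒴) ≤ #(Finset.univ.filter fun T => ι T = 14 ∧ ι Tᶜ = 0) := by
  refine Finset.card_le_card fun T hT => ?_
  rw [Finset.mem_filter]
  exact ⟨Finset.mem_univ _, forcedGoods_good ι hmono 𝒴 T hT⟩

/-! ## Bookkeeping: both orientations -/

/-- Splitting a point count over a symmetric pair set into the two orientations. [this work] -/
theorem card_filter_or_disjoint (ι : Finset γ → Fin 15) (A B : Fin 15 → Fin 15 → Prop) [DecidablePred fun T : Finset γ => A (ι T) (ι Tᶜ)]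
    [DecidablePred fun T : Finset γ => B (ι T) (ι Tᶜ)] [DecidablePred fun T : Finset γ => A (ι T) (ι Tᶜ) ∨ B (ι T) (ι Tᶜ)]
    (hdis : ∀ i j, A i j → ¬ B i j) :
    #(Finset.univ.filter fun T => A (ι T) (ι Tᶜ) ∨ B (ι T) (ι Tᶜ)) =
      #(Finset.univ.filter fun T => A (ι T) (ι Tᶜ)) + #(Finset.univ.filter fun T => B (ι T) (ι Tᶜ)) := by
  have hU : (Finset.univ.filter fun T => A (ι T) (ι Tᶜ) ∨ B (ι T) (ι Tᶜ)) =
      (Finset.univ.filter fun T => A (ι T) (ι Tᶜ)) ∪ (Finset.univ.filter fun T => B (ι T) (ι Tᶜ)) := by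
    ext T; simp only [Finset.mem_filter, Finset.mem_univ, true_and, Finset.mem_union]
  rw [hU]
  refine Finset.card_union_eq_card_add_card.2 ?_
  rw [Finset.disjoint_filter]
  intro T _ hA hB
  exact hdis _ _ hA hB

/-! ## The reduction -/

/-- **`COUNT*` implies the fibre count**, hence `GoodKernel kerU`. [this work] -/
theorem goodKernel_kerU_of_abstractCount (h : AbstractCount) : GoodKernel kerU := by
  classical
  rw [goodKernel_kerU_iff_count]
  intro γ _ _ ι hmono
  -- the configuration of crossing sides
  set 𝒴 : Finset (Finset γ) := Finset.univ.filter fun Y => (ι Yᶜ, ι Y) ∈ uTypesY with h𝒴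
  have htyp : ∀ Y ∈ 𝒴, (ι Yᶜ, ι Y) ∈ uTypesY := fun Y hY => (Finset.mem_filter.1 hY).2
  have hcons : ∀ S ∈ sides 𝒴, ∀ S' ∈ sides 𝒴, S ⊆ S' → ple (ι S) (ι S') = true := fun S _ S' _ hSS' => hmono S S' hSS'
  have hcount := h γ ι 𝒴 htyp hcons
  -- identify the two member counts with oriented point counts
  have hB : #(𝒴.filter fun Y => (ι Yᶜ, ι Y) ∈ uBY) = #(Finset.univ.filter fun T : Finset γ => (ι Tᶜ, ι T) ∈ uBY) := by
    congr 1; ext Y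
    simp only [h𝒴, Finset.mem_filter, Finset.mem_univ, true_and, uTypesY_eq, Finset.mem_union]
    constructor
    · rintro ⟨_, h2⟩; exact h2
    · intro h2; exact ⟨Or.inl h2, h2⟩
  have hD : #(𝒴.filter fun Y => (ι Yᶜ, ι Y) ∈ uDY) = #(Finset.univ.filter fun T : Finset γ => (ι Tᶜ, ι T) ∈ uDY) := by
    congr 1; ext Y
    simp only [h𝒴, Finset.mem_filter, Finset.mem_univ, true_and, uTypesY_eq, Finset.mem_union]
    constructor
    · rintro ⟨_, h2⟩; exact h2
    · intro h2; exact ⟨Or.inr h2, h2⟩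
  -- swap lemmas
  have hBswap : #(Finset.univ.filter fun T : Finset γ => (ι Tᶜ, ι T) ∈ uBY) =
      #(Finset.univ.filter fun T : Finset γ => (ι T, ι Tᶜ) ∈ uBY) :=
    card_filter_compl_swap ι (fun i j => (i, j) ∈ uBY)
  have hDswap : #(Finset.univ.filter fun T : Finset γ => (ι Tᶜ, ι T) ∈ uDY) =
      #(Finset.univ.filter fun T : Finset γ => (ι T, ι Tᶜ) ∈ uDY) :=
    card_filter_compl_swap ι (fun i j => (i, j) ∈ uDY)
  have hTswap : #(Finset.univ.filter fun T : Finset γ => ι Tᶜ = 14 ∧ ι T = 0) =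
      #(Finset.univ.filter fun T : Finset γ => ι T = 14 ∧ ι Tᶜ = 0) :=
    card_filter_compl_swap ι (fun i j => i = 14 ∧ j = 0)
  -- point counts in both orientations
  have hBpts : #(Finset.univ.filter fun T : Finset γ => (ι T, ι Tᶜ) ∈ uB) =
      #(Finset.univ.filter fun T : Finset γ => (ι T, ι Tᶜ) ∈ uBY) + #(Finset.univ.filter fun T : Finset γ => (ι Tᶜ, ι T) ∈ uBY) := by
    have := card_filter_or_disjoint ι (fun i j => (i, j) ∈ uBY) (fun i j => (j, i) ∈ uBY) uBY_asymm
    rw [← this]; congr 1; ext T; simp only [Finset.mem_filter, Finset.mem_univ, true_and]; exact mem_uB_iff _ _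
  have hDpts : #(Finset.univ.filter fun T : Finset γ => (ι T, ι Tᶜ) ∈ uD) =
      #(Finset.univ.filter fun T : Finset γ => (ι T, ι Tᶜ) ∈ uDY) + #(Finset.univ.filter fun T : Finset γ => (ι Tᶜ, ι T) ∈ uDY) := by
    have := card_filter_or_disjoint ι (fun i j => (i, j) ∈ uDY) (fun i j => (j, i) ∈ uDY) uDY_asymm
    rw [← this]; congr 1; ext T; simp only [Finset.mem_filter, Finset.mem_univ, true_and]; exact mem_uD_iff _ _
  have hTpts : #(Finset.univ.filter fun T : Finset γ => (ι T, ι Tᶜ) ∈ uTop) =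
      #(Finset.univ.filter fun T : Finset γ => ι T = 14 ∧ ι Tᶜ = 0) + #(Finset.univ.filter fun T : Finset γ => ι Tᶜ = 14 ∧ ι T = 0) := by
    have := card_filter_or_disjoint ι (fun i j => i = 14 ∧ j = 0) (fun i j => j = 14 ∧ i = 0) top_asymm
    rw [← this]; congr 1; ext T; simp only [Finset.mem_filter, Finset.mem_univ, true_and]; exact mem_uTop_iff _ _
  have hG := card_forcedGoods_le ι hmono 𝒴
  rw [hBpts, hDpts, hTpts, ← hBswap, ← hDswap, hTswap, ← hB, ← hD]
  omega

variable {n : ℕ}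

/-- **`U ≥ 0` on every finite weighted graph from `COUNT*`.** [this work] -/
theorem packU_of_abstractCount (h : AbstractCount) (w : Sym2 (Fin n) → unitInterval) (a b c y : Fin n) :
    2 * (cell w a b c y 11 * (cell w a b c y 2 + cell w a b c y 3 + cell w a b c y 4 + cell w a b c y 5 + cell w a b c y 8 +
        cell w a b c y 9)) +
      (cell w a b c y 2 * (cell w a b c y 10 + cell w a b c y 13) + cell w a b c y 3 * (cell w a b c y 10 + cell w a b c y 12) +
        cell w a b c y 4 * (cell w a b c y 7 + cell w a b c y 13) + cell w a b c y 5 * (cell w a b c y 7 + cell w a b c y 12)) ≤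
      2 * (cell w a b c y 0 * cell w a b c y 14) :=
  packU_of_goodKernel (goodKernel_kerU_of_abstractCount h) w a b c y

end PackU

end Summit.CriticalPhenomena.PercolationContinuityZ3.Theorems
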